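import Summits.QuantumFields.YangMills.Theorems.BalabanUVNodesN13NodeAtRevisedRecordWorldAtRecord13SepCoPHV
import Literature.MathematicalPhysics.QuantumFieldTheory.Balaban1983to89.Node00.Record13SepCoPHChi

/-!
# BalabanUVNodes ∕ N13 — THE Ax TWINS OF THE REVISED-RECORD WORLD's UNFOLDING IDENTITIES: `leavesP_revision₁₃_eq_update` AND THE FLOW∕WINDOW FACES AT THE RE-CENTRED DATUM
# `datumOfRecord₁₃SepCoPHVAx θ h v` (K1ᴬ engine lane, dag-lead g40 HANDS-3 H3.2 supply item (iv), ASSIGNED to seat `pub-ymgap-dag-n24-c`)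

Seat `pub-ymgap-dag-n24-c` (g22); Summits helper lane (`--supports stmt-QuantumFields-27239 --as helper`); theorems only — 0 `def`, 0 `sorry`, 0 `instance`, 0 `notation`.
Imports the non-Ax module `…N13NodeAtRevisedRecordWorldAtRecord13SepCoPHV` (for `WorldP`∕`leavesP`∕vocabulary; nothing of it is re-proved) and `Node00/Record13SepCoPHChi` (the RE-CENTRED
objects `Provisos₁₃SepCoPHAx`, `Revision₁₃Ax`, `datumOfRecord₁₃SepCoPHAx`, `datumOfRecord₁₃SepCoPHVAx`, director-ym №467 (D) σ).

WHAT.  §1 `leavesP_revision₁₃Ax_eq_update` — EVERY LEAF EXCEPT `uvBounds` IS VERSION-BLIND at a world bound to the RE-CENTRED revised datum: `leavesP w P` IS the leaf record of the same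
world re-bound to the re-centred record datum `datumOfRecord₁₃SepCoPHAx θ h` with ONLY the `uvBounds` slot replaced — the verbatim σ-twin of
`N13NodeAtRevisedRecordWorldAtRecord13SepCoPHV.leavesP_revision₁₃_eq_update` (`rfl` after `subst`: the construction's `flow`, `Sect2Form`, `IndAss`, `Cfg` do not read `ρ`; the in-edge leaves
and the 𝐑-leaves read `w.up`).  §2 the two flow faces the K1ᴬ engine's window step reads: `flow_inInterval_revision₁₃Ax_iff` (the run's flow at the re-centred revised datum IS the
forward-generated flow of the RE-CENTRED β `betaOfRecord₁₃Ax θ`, `Iff.rfl`) and its datum-of-record form `flow_inInterval_datumOfRecord₁₃SepCoPHAx_iff`.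

HONEST FRAMING.  Kernel unfolding identities (`rfl` ∕ `Iff.rfl`); NO estimate of Bałaban's; N13 NOT discharged; K1ᴬ DECIDING∕OPEN; count-neutral; finite 𝕋⁴ at fixed ε — NOT continuum ∕ OS ∕ Clay;
the Yang–Mills mass gap is NOT proved.  Sources (context only): [V] = [Balaban1989LargeFieldII] CMP **122** (1989) Thm 1 p.355, (0.1) pp.355–356; [III] = [Balaban1988Convergent] CMP **119** (1988)
(0.2) p.244, (2.18) p.257; [I] = [Balaban1987RG1] CMP **109** (1987) (0.17)–(0.20) pp.255–256; [14] = [Balaban1988RG2Cluster] CMP **116** (1988) (2.9).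
-/

noncomputable section

namespace Summit.QuantumFields.YangMills.BalabanUVNodes.N13NodeAtRevisedRecordWorldAtRecord13SepCoPHVAx

open Literature.MathematicalPhysics.QuantumFieldTheory.Balaban1983to89
open T4Continuum Node00 DagBinding T4DatumAssembly FlowStepRuns

variable (F : T4Family) (N : ℕ) [NeZero N]

/-! ## §1. Every leaf except `uvBounds` is version-blind at the RE-CENTRED revised datum -/

section Unfold

variable (θ : Stage13HParams F N) (h : θ.Provisos₁₃SepCoPHAx F N) (v : Revision₁₃Ax F N θ h) (w : WorldP) (P : B12.RunParams)

/-- **EVERY LEAF EXCEPT `uvBounds` IS VERSION-BLIND AT THE RE-CENTRED REVISED DATUM** (`rfl` after `subst`) — the Ax twin of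
`N13NodeAtRevisedRecordWorldAtRecord13SepCoPHV.leavesP_revision₁₃_eq_update` (dag-lead g40 HANDS-3 H3.2 (iv)): at a world bound to `datumOfRecord₁₃SepCoPHVAx θ h v`, the run's leaf values ARE
those of the same world re-bound to the re-centred record datum `datumOfRecord₁₃SepCoPHAx θ h`, with ONLY the `uvBounds` slot replaced (the construction's `flow`, `Sect2Form`, `IndAss`, `Cfg`
do not read `ρ`; the ten in-edge leaves and the two 𝐑-leaves read `w.up`). [cite: Balaban1989LargeFieldII, Thm 1 p.355 (bookkeeping); Balaban1988Convergent, (0.2) p.244, (2.18) p.257 (bookkeeping); Balaban1988RG2Cluster, (2.9) p.12 (bookkeeping)] -/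
theorem leavesP_revision₁₃Ax_eq_update (hC : w.C = (datumOfRecord₁₃SepCoPHVAx F N θ h v).C) :
    leavesP w P = { leavesP { w with C := (datumOfRecord₁₃SepCoPHAx F N θ h).C } P with uvBounds := (leavesP w P).uvBounds } := by
  obtain ⟨C, up, γ, L, b, βup, β₀, gR, em, ep⟩ := w
  cases hC
  rfl

end Unfold

/-! ## §2. The flow ∕ window faces at the RE-CENTRED datum (what the K1ᴬ engine's window step reads) -/

section Flow

variable (θ : Stage13HParams F N) (h : θ.Provisos₁₃SepCoPHAx F N) (v : Revision₁₃Ax F N θ h) (P : B12.RunParams)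

/-- The run's flow at the RE-CENTRED revised datum IS the forward-generated flow of the RE-CENTRED β of record (`Iff.rfl`) — Ax twin of
`N13NodeAtRevisedRecordWorldAtRecord13SepCoPHV.flow_inInterval_revision₁₃_iff`. [cite: Balaban1987RG1, (0.17)–(0.20) pp.255–256 (bookkeeping)] -/
theorem flow_inInterval_revision₁₃Ax_iff (γ : ℝ) :
    ((datumOfRecord₁₃SepCoPHVAx F N θ h v).C P).flow.InInterval γ P.K ↔ (genFlow (betaOfRecord₁₃Ax F N θ.toStage13Params) P.g0).InInterval γ P.K :=
  Iff.rfl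

/-- The same face at the RE-CENTRED datum of record (trivial revision; `Iff.rfl`). [cite: Balaban1987RG1, (0.17)–(0.20) pp.255–256 (bookkeeping)] -/
theorem flow_inInterval_datumOfRecord₁₃SepCoPHAx_iff (γ : ℝ) :
    ((datumOfRecord₁₃SepCoPHAx F N θ h).C P).flow.InInterval γ P.K ↔ (genFlow (betaOfRecord₁₃Ax F N θ.toStage13Params) P.g0).InInterval γ P.K :=
  Iff.rfl

/-- **THE WINDOW CLAUSE IS VERSION-FREE at the re-centred record** (`Iff.rfl`): K1ᴬ's window conjunct at `datumOfRecord₁₃SepCoPHVAx θ h v` ↔ the same at `datumOfRecord₁₃SepCoPHAx θ h`.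
[cite: Balaban1987RG1, Thm 1 p.259 (the interval `]0, γ]`) (bookkeeping)] -/
theorem window_datumOfRecord₁₃SepCoPHVAx_iff :
    (∃ γ₁ : ℝ, 0 < γ₁ ∧ ∀ γ : ℝ, 0 < γ → γ ≤ γ₁ → ∃ P : B12.RunParams, 1 ≤ P.K ∧ ((datumOfRecord₁₃SepCoPHVAx F N θ h v).C P).flow.InInterval γ P.K) ↔
      ∃ γ₁ : ℝ, 0 < γ₁ ∧ ∀ γ : ℝ, 0 < γ → γ ≤ γ₁ → ∃ P : B12.RunParams, 1 ≤ P.K ∧ ((datumOfRecord₁₃SepCoPHAx F N θ h).C P).flow.InInterval γ P.K :=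
  Iff.rfl

end Flow

end Summit.QuantumFields.YangMills.BalabanUVNodes.N13NodeAtRevisedRecordWorldAtRecord13SepCoPHVAx

end
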